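import Literature.Geometry.Symplectic.SteinReparametrisation
import Literature.Analysis.Pluripotential.RegularisedMax
import HarnessLib

/-!
# The regularised maximum of two `J`-convex functions is `J`-convex

Topic `Literature/Geometry/Symplectic`; proofs file of the fact seat of
`Literature.Geometry.Symplectic.Gompf1998_thm13_twoHandles` (**E2**, `SteinTwoHandles.lean`),
step "`J`-convex surgery": the new `J`-convex function on `W_c ∪ handle` is obtained from `φ`
and the model function of the standard handle by a *smooth maximum* (Eliashberg 1990, §2;
Cieliebak–Eliashberg 2012, §3.1–§3.2 and Ch. 8).  In the tree's formalism (`SteinDomain.lean`: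
`d^ℂφ = dφ ∘ J`, Levi form `-dd^ℂφ(v, Jv)`, for a field `J` preserving smooth vector fields
with `J² = -1` on a `4`-manifold with boundary) and with the tree's regularised maximum
`Literature.Analysis.Pluripotential.smoothMax η x y = (x + y + η S((x - y)/η)) / 2`
(`RegularisedMax.lean`: `S = smoothAbs` smooth, convex, even, `= |·|` off `(-1, 1)`, `S' = σ =
smoothSign`, `|σ| ≤ 1`, `σ' ≥ 0`; `max ≤ m_η ≤ max + η`, `m_η(x, y) = x` for `x ≥ y + η`) this
file proves:

* `dComplex_add`, `dComplex_const_mul`, `dComplex_sub` and `levi_add`, `levi_const_mul`,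
  `levi_sub` — **the Levi form is linear in the function**;
* `hasDerivAt_scaledSmoothAbs`, `deriv_scaledSmoothAbs`, `deriv_deriv_scaledSmoothAbs`,
  `contDiff_scaledSmoothAbs` — calculus of the rescaled profile `t ↦ η S(t/η)`;
* `contMDiff_smoothMax₂` — `x ↦ m_η(φ x, ψ x)` is smooth for smooth `φ`, `ψ`;
* `levi_smoothMax₂` — **the Levi form of the regularised maximum**: with `g = φ - ψ`,
  `σ = smoothSign (g x / η)`, `σ' = smoothSign' (g x / η)`:
  `Levi(m_η(φ, ψ))(v, Jv) = ½ ((1 + σ) Levi(φ) + (1 - σ) Levi(ψ) + (σ'/η)(dg(v)² + dg(Jv)²))`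
  (linearity and the one-variable composition formula `levi_real_comp` of
  `SteinReparametrisation.lean`) — the manifold / almost-complex counterpart of the flat
  `Literature.Analysis.Pluripotential.levi_smoothMax_nonneg`;
* `levi_smoothMax₂_pos` — hence **`m_η(φ, ψ)` is `J`-convex wherever `φ` and `ψ` are**.

Everything is **proved**; no definition, no named fact.

## References

* K. Cieliebak, Ya. Eliashberg, *From Stein to Weinstein and Back*, AMS Colloquium Publ. 59
  (2012), §3.1 (maxima of `J`-convex functions and their smoothing). [CieliebakEliashberg2012]
* Ya. Eliashberg, *Topological characterization of Stein manifolds of dimension > 2*, Internat.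
  J. Math. 1 (1990), §2. [Eliashberg1990Stein]
* J.-P. Demailly, *Complex analytic and differential geometry*, Ch. I, Lemma 5.18 (regularised
  maximum). [folklore]
-/

noncomputable section

open scoped Manifold ContDiff Topology
open Set Function Filter

namespace Literature.Geometry.Symplectic

open Literature.Geometry.Kaehler Literature.Analysis.Pluripotential

variable {W : Type*} [TopologicalSpace W] [ChartedSpace (EuclideanHalfSpace 4) W]
  [IsManifold (𝓡∂ 4) ∞ W]

/-! ### The Levi form is linear in the function -/

section Linear

variable (J : (x : W) → (EuclideanSpace ℝ (Fin 4) →L[ℝ] EuclideanSpace ℝ (Fin 4)))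

omit [IsManifold (𝓡∂ 4) ∞ W] in
/-- `d^ℂ(φ + ψ) = d^ℂφ + d^ℂψ`. [folklore] -/
theorem dComplex_add {φ ψ : W → ℝ} (hφ : MDifferentiable (𝓡∂ 4) 𝓘(ℝ, ℝ) φ)
    (hψ : MDifferentiable (𝓡∂ 4) 𝓘(ℝ, ℝ) ψ) :
    dComplex J (φ + ψ) = dComplex J φ + dComplex J ψ := by
  funext x
  ext w
  have h : rd (φ + ψ) x = rd φ x + rd ψ x := mfderiv_add (hφ x) (hψ x)
  show rd (φ + ψ) x (J x (w 0)) = rd φ x (J x (w 0)) + rd ψ x (J x (w 0))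
  rw [h]
  rfl

omit [IsManifold (𝓡∂ 4) ∞ W] in
/-- `d^ℂ(a φ) = a d^ℂφ`. [folklore] -/
theorem dComplex_const_mul {φ : W → ℝ} (hφ : MDifferentiable (𝓡∂ 4) 𝓘(ℝ, ℝ) φ) (a : ℝ) :
    dComplex J (fun x => a * φ x) = a • dComplex J φ := by
  funext x
  ext w
  have h : rd (fun x => a * φ x) x = a • rd φ x := ((hφ x).hasMFDerivAt.const_smul a).mfderiv
  show rd (fun x => a * φ x) x (J x (w 0)) = a • rd φ x (J x (w 0))
  rw [h]
  rfl

omit [IsManifold (𝓡∂ 4) ∞ W] in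
/-- `d^ℂ(φ - ψ) = d^ℂφ + (-1) • d^ℂψ`. [folklore] -/
theorem dComplex_sub {φ ψ : W → ℝ} (hφ : MDifferentiable (𝓡∂ 4) 𝓘(ℝ, ℝ) φ)
    (hψ : MDifferentiable (𝓡∂ 4) 𝓘(ℝ, ℝ) ψ) :
    dComplex J (φ - ψ) = dComplex J φ + (-1 : ℝ) • dComplex J ψ := by
  funext x
  ext w
  have h : rd (φ - ψ) x = rd φ x - rd ψ x := mfderiv_sub (hφ x) (hψ x)
  show rd (φ - ψ) x (J x (w 0)) = rd φ x (J x (w 0)) + (-1 : ℝ) • rd ψ x (J x (w 0))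
  rw [h]
  show rd φ x (J x (w 0)) - rd ψ x (J x (w 0)) = _
  rw [neg_one_smul, sub_eq_add_neg]

variable {J} [T2Space W] (hJ : PreservesSmoothFields J)
include hJ

/-- **The Levi form is additive in the function.** [cite: CieliebakEliashberg2012, §3.1] -/
theorem levi_add {φ ψ : W → ℝ} (hφ : ContMDiff (𝓡∂ 4) 𝓘(ℝ, ℝ) ∞ φ)
    (hψ : ContMDiff (𝓡∂ 4) 𝓘(ℝ, ℝ) ∞ ψ) (x : W) (V : Fin 2 → EuclideanSpace ℝ (Fin 4)) :
    -(mextDeriv (dComplex J (φ + ψ)) x V) =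
      -(mextDeriv (dComplex J φ) x V) + -(mextDeriv (dComplex J ψ) x V) := by
  rw [dComplex_add J (hφ.mdifferentiable (by simp)) (hψ.mdifferentiable (by simp)),
    mextDeriv_add (isSmoothForm_dComplex_of_preservesSmoothFields hJ hφ)
      (isSmoothForm_dComplex_of_preservesSmoothFields hJ hψ)]
  show -((mextDeriv (dComplex J φ) x + mextDeriv (dComplex J ψ) x) V) = _
  rw [ContinuousAlternatingMap.add_apply, neg_add]

omit [IsManifold (𝓡∂ 4) ∞ W] [T2Space W] hJ in
/-- **The Levi form is homogeneous in the function.** [cite: CieliebakEliashberg2012, §3.1] -/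
theorem levi_const_mul {φ : W → ℝ} (hφ : ContMDiff (𝓡∂ 4) 𝓘(ℝ, ℝ) ∞ φ) (a : ℝ) (x : W)
    (V : Fin 2 → EuclideanSpace ℝ (Fin 4)) :
    -(mextDeriv (dComplex J (fun x => a * φ x)) x V) = a * -(mextDeriv (dComplex J φ) x V) := by
  rw [dComplex_const_mul J (hφ.mdifferentiable (by simp)) a, mextDeriv_smul]
  show -(a • mextDeriv (dComplex J φ) x V) = _
  rw [smul_eq_mul, mul_neg]

/-- **The Levi form of a difference.** [cite: CieliebakEliashberg2012, §3.1] -/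
theorem levi_sub {φ ψ : W → ℝ} (hφ : ContMDiff (𝓡∂ 4) 𝓘(ℝ, ℝ) ∞ φ)
    (hψ : ContMDiff (𝓡∂ 4) 𝓘(ℝ, ℝ) ∞ ψ) (x : W) (V : Fin 2 → EuclideanSpace ℝ (Fin 4)) :
    -(mextDeriv (dComplex J (φ - ψ)) x V) =
      -(mextDeriv (dComplex J φ) x V) - -(mextDeriv (dComplex J ψ) x V) := by
  have hsφ := isSmoothForm_dComplex_of_preservesSmoothFields hJ hφ
  have hsψ := isSmoothForm_dComplex_of_preservesSmoothFields hJ hψ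
  rw [dComplex_sub J (hφ.mdifferentiable (by simp)) (hψ.mdifferentiable (by simp)),
    mextDeriv_add hsφ (hsψ.smul (-1)), mextDeriv_smul]
  show -((mextDeriv (dComplex J φ) x + (-1 : ℝ) • mextDeriv (dComplex J ψ) x) V) = _
  rw [ContinuousAlternatingMap.add_apply, ContinuousAlternatingMap.smul_apply, smul_eq_mul]
  ring

end Linear

/-! ### The rescaled profile `t ↦ η S(t/η)` -/

section Profile

variable {η : ℝ}

/-- `(η S(·/η))' = σ(·/η)` (`η ≠ 0`). [folklore] -/
theorem hasDerivAt_scaledSmoothAbs (hη : η ≠ 0) (t : ℝ) :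
    HasDerivAt (fun t : ℝ => η * smoothAbs (t / η)) (smoothSign (t / η)) t := by
  have h1 : HasDerivAt (fun t : ℝ => t / η) (1 / η) t := (hasDerivAt_id t).div_const η
  have h2 := ((hasDerivAt_smoothAbs (t / η)).comp t h1).const_mul η
  refine h2.congr_deriv ?_
  field_simp

/-- `deriv (η S(·/η)) = σ(·/η)` (`η ≠ 0`). [folklore] -/
theorem deriv_scaledSmoothAbs (hη : η ≠ 0) :
    deriv (fun t : ℝ => η * smoothAbs (t / η)) = fun t => smoothSign (t / η) :=
  funext fun t => (hasDerivAt_scaledSmoothAbs hη t).deriv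

/-- `(η S(·/η))'' (t) = σ'(t/η) / η` (`η ≠ 0`). [folklore] -/
theorem deriv_deriv_scaledSmoothAbs (hη : η ≠ 0) (t : ℝ) :
    deriv (deriv (fun t : ℝ => η * smoothAbs (t / η))) t = deriv smoothSign (t / η) / η := by
  rw [deriv_scaledSmoothAbs hη]
  have h1 : HasDerivAt (fun t : ℝ => t / η) (1 / η) t := (hasDerivAt_id t).div_const η
  have h2 : HasDerivAt (fun t : ℝ => smoothSign (t / η)) (deriv smoothSign (t / η) * (1 / η)) t := by
    have h := (hasDerivAt_smoothSign (t / η)).comp t h1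
    exact h
  rw [h2.deriv]
  ring

/-- `(η S(·/η))'' ≥ 0` for `η > 0`. [folklore] -/
theorem deriv_deriv_scaledSmoothAbs_nonneg (hη : 0 < η) (t : ℝ) :
    0 ≤ deriv (deriv (fun t : ℝ => η * smoothAbs (t / η))) t := by
  rw [deriv_deriv_scaledSmoothAbs hη.ne']
  exact div_nonneg (deriv_smoothSign_nonneg _) hη.le

/-- `η S(·/η)` is smooth. [folklore] -/
theorem contDiff_scaledSmoothAbs (η : ℝ) : ContDiff ℝ ∞ fun t : ℝ => η * smoothAbs (t / η) :=
  contDiff_const.mul ((contDiff_smoothAbs (n := ⊤)).comp (contDiff_id.div_const η))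

end Profile

/-! ### The regularised maximum of two functions on `W` -/

section SmoothMax

omit [TopologicalSpace W] [ChartedSpace (EuclideanHalfSpace 4) W] [IsManifold (𝓡∂ 4) ∞ W] in
/-- The regularised maximum of two functions as `½ · (φ + ψ + (η S(·/η)) ∘ (φ - ψ))` (the form in
which its Levi form is computed). [folklore] -/
theorem smoothMax₂_eq (η : ℝ) (φ ψ : W → ℝ) :
    (fun x => smoothMax η (φ x) (ψ x)) =
      fun x => 1 / 2 * ((φ + ψ) + (fun t : ℝ => η * smoothAbs (t / η)) ∘ (φ - ψ)) x := by
  funext x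
  simp only [smoothMax, Pi.add_apply, comp_apply, Pi.sub_apply]
  ring

omit [IsManifold (𝓡∂ 4) ∞ W] in
/-- **The regularised maximum of smooth functions is smooth.** [folklore] -/
theorem contMDiff_smoothMax₂ (η : ℝ) {φ ψ : W → ℝ} (hφ : ContMDiff (𝓡∂ 4) 𝓘(ℝ, ℝ) ∞ φ)
    (hψ : ContMDiff (𝓡∂ 4) 𝓘(ℝ, ℝ) ∞ ψ) :
    ContMDiff (𝓡∂ 4) 𝓘(ℝ, ℝ) ∞ fun x => smoothMax η (φ x) (ψ x) := by
  rw [smoothMax₂_eq]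
  have h1 : ContMDiff (𝓡∂ 4) 𝓘(ℝ, ℝ) ∞ ((fun t : ℝ => η * smoothAbs (t / η)) ∘ (φ - ψ)) :=
    (contDiff_scaledSmoothAbs η).comp_contMDiff (hφ.sub hψ)
  exact contMDiff_const.mul ((hφ.add hψ).add h1)

variable [T2Space W] {J : (x : W) → (EuclideanSpace ℝ (Fin 4) →L[ℝ] EuclideanSpace ℝ (Fin 4))}

/-- **The Levi form of the regularised maximum.**  With `g = φ - ψ`, `σ = smoothSign (g x / η)`,
`σ' = smoothSign' (g x / η)` and `L(χ) = -dd^ℂχ_x(v, Jv)`: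
`L(m_η(φ, ψ)) = ½ ((1 + σ) L(φ) + (1 - σ) L(ψ) + (σ'/η) (dg(v)² + dg(Jv)²))`
(linearity of the Levi form and `levi_real_comp` for `(η S(·/η)) ∘ g`); compare the flat
`Literature.Analysis.Pluripotential.levi_smoothMax_nonneg`. [cite: CieliebakEliashberg2012, §3.1] -/
theorem levi_smoothMax₂ (hJ : PreservesSmoothFields J) (hJ2 : ∀ x v, J x (J x v) = -v) {η : ℝ}
    (hη : η ≠ 0) {φ ψ : W → ℝ} (hφ : ContMDiff (𝓡∂ 4) 𝓘(ℝ, ℝ) ∞ φ)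
    (hψ : ContMDiff (𝓡∂ 4) 𝓘(ℝ, ℝ) ∞ ψ) (x : W) (v : EuclideanSpace ℝ (Fin 4)) :
    -(mextDeriv (dComplex J fun x => smoothMax η (φ x) (ψ x)) x ![v, J x v]) =
      1 / 2 * ((1 + smoothSign ((φ x - ψ x) / η)) * -(mextDeriv (dComplex J φ) x ![v, J x v]) +
        (1 - smoothSign ((φ x - ψ x) / η)) * -(mextDeriv (dComplex J ψ) x ![v, J x v]) +
        deriv smoothSign ((φ x - ψ x) / η) / η *
          (rd (φ - ψ) x v ^ 2 + rd (φ - ψ) x (J x v) ^ 2)) := by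
  have hg : ContMDiff (𝓡∂ 4) 𝓘(ℝ, ℝ) ∞ (φ - ψ) := hφ.sub hψ
  have hθg : ContMDiff (𝓡∂ 4) 𝓘(ℝ, ℝ) ∞ ((fun t : ℝ => η * smoothAbs (t / η)) ∘ (φ - ψ)) :=
    (contDiff_scaledSmoothAbs η).comp_contMDiff hg
  have hsum : ContMDiff (𝓡∂ 4) 𝓘(ℝ, ℝ) ∞
      ((φ + ψ) + (fun t : ℝ => η * smoothAbs (t / η)) ∘ (φ - ψ)) := (hφ.add hψ).add hθg
  rw [smoothMax₂_eq, levi_const_mul hsum, levi_add hJ (hφ.add hψ) hθg, levi_add hJ hφ hψ,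
    levi_real_comp hJ hJ2 hg ((contDiff_scaledSmoothAbs η).of_le (by norm_cast)) x v,
    levi_sub hJ hφ hψ, deriv_deriv_scaledSmoothAbs hη, deriv_scaledSmoothAbs hη]
  have hgx : (φ - ψ) x = φ x - ψ x := rfl
  rw [hgx]
  ring

/-- **The regularised maximum of two `J`-convex functions is `J`-convex.**  If
`-dd^ℂφ_x(v, Jv) > 0` and `-dd^ℂψ_x(v, Jv) > 0` for all `v ≠ 0`, the same holds for
`m_η(φ, ψ)` (`η > 0`): in `levi_smoothMax₂` the coefficients `1 ± σ` are `≥ 0` with sum `2`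
(`|σ| ≤ 1`) and the last term is `≥ 0` (`σ' ≥ 0`). [cite: CieliebakEliashberg2012, §3.1] -/
theorem levi_smoothMax₂_pos (hJ : PreservesSmoothFields J) (hJ2 : ∀ x v, J x (J x v) = -v)
    {η : ℝ} (hη : 0 < η) {φ ψ : W → ℝ} (hφ : ContMDiff (𝓡∂ 4) 𝓘(ℝ, ℝ) ∞ φ)
    (hψ : ContMDiff (𝓡∂ 4) 𝓘(ℝ, ℝ) ∞ ψ) {x : W}
    (hφc : ∀ v : EuclideanSpace ℝ (Fin 4), v ≠ 0 → 0 < -(mextDeriv (dComplex J φ) x ![v, J x v]))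
    (hψc : ∀ v : EuclideanSpace ℝ (Fin 4), v ≠ 0 → 0 < -(mextDeriv (dComplex J ψ) x ![v, J x v]))
    {v : EuclideanSpace ℝ (Fin 4)} (hv : v ≠ 0) :
    0 < -(mextDeriv (dComplex J fun x => smoothMax η (φ x) (ψ x)) x ![v, J x v]) := by
  rw [levi_smoothMax₂ hJ hJ2 hη.ne' hφ hψ x v]
  set s := smoothSign ((φ x - ψ x) / η) with hs
  obtain ⟨hs1, hs2⟩ := abs_le.1 (abs_smoothSign_le_one ((φ x - ψ x) / η))
  have h1 := hφc v hv
  have h2 := hψc v hv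
  have h3 : 0 ≤ deriv smoothSign ((φ x - ψ x) / η) / η *
      (rd (φ - ψ) x v ^ 2 + rd (φ - ψ) x (J x v) ^ 2) :=
    mul_nonneg (div_nonneg (deriv_smoothSign_nonneg _) hη.le) (by positivity)
  have h4 : 0 ≤ (1 + s) * -(mextDeriv (dComplex J φ) x ![v, J x v]) :=
    mul_nonneg (by linarith) h1.le
  have h5 : 0 ≤ (1 - s) * -(mextDeriv (dComplex J ψ) x ![v, J x v]) :=
    mul_nonneg (by linarith) h2.le
  rcases le_or_gt 0 s with hs0 | hs0
  · nlinarith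
  · nlinarith

omit [TopologicalSpace W] [ChartedSpace (EuclideanHalfSpace 4) W] [IsManifold (𝓡∂ 4) ∞ W] [T2Space W] in
/-- **Bounds and rigidity of the regularised maximum** on `W` (from `RegularisedMax.lean`):
`max (φ x) (ψ x) ≤ m_η(φ x, ψ x) ≤ max (φ x) (ψ x) + η`, and `m_η(φ x, ψ x) = φ x` where
`φ x ≥ ψ x + η`. [folklore] -/
theorem smoothMax₂_bounds {η : ℝ} (hη : 0 < η) (φ ψ : W → ℝ) (x : W) :
    max (φ x) (ψ x) ≤ smoothMax η (φ x) (ψ x) ∧ smoothMax η (φ x) (ψ x) ≤ max (φ x) (ψ x) + η ∧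
      (ψ x + η ≤ φ x → smoothMax η (φ x) (ψ x) = φ x) :=
  ⟨max_le_smoothMax hη _ _, smoothMax_le_max_add hη _ _, fun h => smoothMax_eq_left hη h⟩

end SmoothMax

end Literature.Geometry.Symplectic

end
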